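import Summits.Ventures.PercRepro.RankLevelSetLevelSixHeavyCell
import Summits.Ventures.PercRepro.RankLevelSetDepCountHeavySq
import Summits.Ventures.PercRepro.RankLevelSetLevelSix
import Summits.Ventures.PercRepro.S1FourCircuitCount
import Summits.Ventures.PercRepro.RankLevelSetPlaneSix
import Summits.Ventures.PercRepro.S1TriangleCount
import Summits.Ventures.PercRepro.RankLevelSetTriangleStar
import Summits.Ventures.PercRepro.RankLevelSetCorankFiveCounts
import Summits.Ventures.PercRepro.RankLevelSetPlaneTen
import Summits.Ventures.PercRepro.RankLevelSetPlaneTenPrime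
import Summits.Ventures.PercRepro.S1TrianglePlusPlus
import Summits.Ventures.PercRepro.S1CoreFourCircuitSum
import Summits.Ventures.PercRepro.RankLevelSetDepCountHeavyU
import Summits.Ventures.PercRepro.RankLevelSetCoreFour
import Summits.Ventures.PercRepro.RankLevelSetFrameLarge
import Summits.Ventures.PercRepro.RankLevelSetFrameQM
import Summits.Ventures.PercRepro.RankLevelSetLevelFiveAll
import Summits.Ventures.PercRepro.RankLevelSetLevelSixGiant

/-!
# PercRepro — THE HEAVY / LIGHT COUNT AT LEVEL `6` WITH THE SQUARE MULTIPLICITY AND RATIONAL TAILS, ON THE FLAT BOUNDS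
`f(6) ≤ 39`, `f(5) ≤ 19`, WITH LEMMAS T⁺⁺ AND T4⁺, THE FLAT-COUNT TAIL AND THE UNIQUE HEAVY FLAT: ONE CORE CELL (p8 g3, S3)

`proofs/SUBCLAIM-S3-p8.md` §3l. The cell theorem `c025_core_six_heavy_cell_sq` of RankLevelSetLevelSixHeavyCellSq
(p7's SQUARE MULTIPLICITY, light weights `1/(j + 1)²`; RATIONAL tail constant `Kn/Kd`) re-cut on the tree's sharper
flat bounds of the `e`-free core — `f(6) ≤ 39` (`ncard_le_thirtynine_of_eRk_le_six_of_free`) in place of `43` and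
`f(5) ≤ 19` (`ncard_le_nineteen_of_eRk_le_five_of_free`) in place of `21` (mine-4, RankLevelSetPlaneTenPrime): the
small-closure weight `σ₁²` runs over `min (min 19 (5 + d) − 6) (ν₁ − 2)` free points and the tail's rank-`≤ 6` count
over `a ≥ min 39 (6 + d)` — the cell theorem `c025_core_six_heavy_cell_sq39` of RankLevelSetLevelSixHeavyCellSq39 — with two
more levers of the tree: (i) p1's LEMMA T⁺⁺ (`S1.ncard_triangles_le_of_nullity_plane`, S1TrianglePlusPlus) in place of
LEMMA T — `s₃ ≤ (d² − 3d + 8)/2` under the line and plane bounds of the core, in place of `d(d + 1)/2`; (ii) THE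
FLAT-COUNT TAIL: the rank-`≤ 6` sets are the rank-`≤ 5` sets (`≤ 19` points each: `≤ Σ_{j ≤ 19} C(n, j)`) plus the
rank-`6` sets (`≤ C(n, 6)·2^{33}`, every one inside the closure of an independent `6`-set of `≤ 39` points —
`ncard_eRk_eq_le_choose_mul_of_bound`), which at large corank is far below the crude `Σ_{j ≤ 39} C(n, j)`; the tail
hypothesis `htail` accepts EITHER form; (iii) THE UNIQUE HEAVY FLAT (RankLevelSetDepCountHeavyU): when `2ν₁ ≥ d + 15`
two heavy rank-`6` flats would meet in a rank-`≤ 5` set of nullity `> 14`, so there is at most one and `|UG| ≤ min 39 (6 + d)` —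
the hypothesis `huG` accepts that bound in place of the union bound `6 + (j + 1)d − jν₁`. **`c025_core_six_heavy_cell_sq38t`**
(§3l); its `ν₁ = 34` form without heavy sets is `c025_core_six_heavy_cell_sq40_top` (RankLevelSetLevelSixHeavyCellSq40Top).
-/

open scoped Matroid

namespace PercRepro

namespace ThmN

open Set

variable {α : Type}

/-- **ONE CORE CELL AT LEVEL `6`, SQUARE MULTIPLICITY, RATIONAL TAIL `Kn/Kd`.** Parameters: the
nullity threshold `ν₁ ≥ 7`, the rank jumps `j` (rank-`6` flats) and `j′` (rank-`5` flats) with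
`d + cnull(5 − j) + 1 ≤ 2ν₁` and `d + cnull(4 − j′) + 1 ≤ 2ν₁`, the exponents `uG ≥ 6 + (j+1)d − jν₁`,
`uH` (from the plain union bound, the unique-flat bound `f′ = min 19 (5 + d)`, or the empty case), and `b ∈ {0, 1}`
with `b = 0` only when `6 + ν₁ ≤ f′ + 2` (no light big pair); the tail's `a ≥ min 39 (6 + d)`, or the flat-count form
`Σ_{j ≤ 19} C(n, j) + 2^{33}·Σ_{j ≤ 6} C(n, j)`; `s₃ ≤ (d² − 3d + 8)/2` (LEMMA T⁺⁺); `uG ≥ min 39 (6 + d)` is enough when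
`2ν₁ ≥ d + 15` (the unique heavy flat); `s₄ ≤ d(d+1)(d+2)/4` (LEMMA T4⁺, p1's `S1.four_mul_ncard_fourCircuits_le`). -/
theorem c025_core_six_heavy_cell_sq38t (M : Matroid α) [M.Finite] (p d ν₁ j j' uG uH b Kn Kd a : ℕ) (hd7 : 7 ≤ d)
    (hd50 : d ≤ 50) (hν7 : 7 ≤ ν₁) (hj : 1 ≤ j) (hj5 : j ≤ 5) (hj' : 1 ≤ j') (hj'4 : j' ≤ 4)
    (hνj : d + cnull (5 - j) + 1 ≤ 2 * ν₁) (hνj' : d + cnull (4 - j') + 1 ≤ 2 * ν₁)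
    (huG : 6 + (j + 1) * d ≤ uG + j * ν₁ ∨ (d + 14 + 1 ≤ 2 * ν₁ ∧ min 39 (6 + d) ≤ uG))
    (huH : 5 + (j' + 1) * d ≤ uH + j' * ν₁ ∨ (d + 7 ≤ 2 * ν₁ ∧ min 19 (5 + d) ≤ uH) ∨
      min 19 (5 + d) + 1 ≤ 5 + ν₁)
    (hb : 6 + ν₁ ≤ min 19 (5 + d) + 2 ∨ b = 1) (hK : Kd < Kn) (hKd : 0 < Kd) (ha : min 39 (6 + d) ≤ a)
    (htail : Kn * (∑ j ∈ Finset.range (a + 1), (p + d).choose j + ∑ j ∈ Finset.range (d + 1), (p + d).choose j) ≤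
        Kd * 2 ^ (p + d) ∨
      Kn * (∑ j ∈ Finset.range (19 + 1), (p + d).choose j + 2 ^ (39 - 6) * ∑ j ∈ Finset.range (6 + 1), (p + d).choose j +
        ∑ j ∈ Finset.range (d + 1), (p + d).choose j) ≤ Kd * 2 ^ (p + d))
    (hR : M.eRank = (p : ℕ∞)) (hn : M.E.ncard = p + d)
    (hfree : ∀ e ∈ M.E, ∃ A ⊆ M.E \ {e}, e ∉ M.closure A ∧ e ∉ M.closure ((M.E \ {e}) \ A))
    (hpoly : (Kn : ℚ) * ((((p + d).choose 6 : ℕ) : ℚ) +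
      ((∑ i ∈ Finset.range (d - 7 + 1), ((Nat.choose (min (min 19 (5 + d) - 6) (ν₁ - 2)) i : ℕ) : ℚ) / (((i : ℚ) + 1) ^ 2)) *
        ((((d * d + 8 - 3 * d) / 2 : ℕ) : ℚ) * ((p + d).choose 4 : ℚ) + ((d * (d + 1) * (d + 2) / 4 : ℕ) : ℚ) * ((p + d).choose 3 : ℚ) +
          (((d + 4).choose 5 : ℕ) : ℚ) * ((p + d).choose 2 : ℚ) + (((d + 5).choose 6 : ℕ) : ℚ) * ((p + d : ℕ) : ℚ) +
          (((d + 6).choose 7 : ℕ) : ℚ)) +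
      ((b : ℕ) : ℚ) * (∑ i ∈ Finset.range (d - 7 + 1), ((Nat.choose (ν₁ - 2) i : ℕ) : ℚ) / (((i : ℚ) + 1) ^ 2)) *
        ((((d * d + 8 - 3 * d) / 2 : ℕ) : ℚ) * ((p + d).choose 4 : ℚ) + ((d * (d + 1) * (d + 2) / 4 : ℕ) : ℚ) * ((p + d).choose 3 : ℚ) +
          (((d + 4).choose 5 : ℕ) : ℚ) * ((p + d).choose 2 : ℚ) + (((d + 5).choose 6 : ℕ) : ℚ) * ((p + d : ℕ) : ℚ) +
          (((d + 6).choose 7 : ℕ) : ℚ)) +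
      (2 : ℚ) ^ uG + (((p + d : ℕ) : ℚ) + 1) * (2 : ℚ) ^ uH)) ≤
      ((Kn - Kd : ℕ) : ℚ) * 2 ^ (d - 6) * (((p + 6).choose 6 : ℕ) : ℚ)) :
    RLS M p 6 := by
  classical
  have hEcard : M.ground_finite.toFinset.card = p + d := by
    rw [← Set.ncard_eq_toFinset_card _ M.ground_finite]; exact hn
  -- the core is simple: every circuit has `≥ 3` elements
  have hL : ∀ e ∈ M.E, ¬ M.IsLoop e := not_isLoop_of_free M hfree
  have hs : ∀ e ∈ M.E, ∀ f ∈ M.E, e ≠ f → M.eRk {e, f} = 2 := by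
    intro e he f hf hef
    have h2 : (2 : ℕ∞) ≤ M.eRk {e, f} :=
      two_le_eRk_of_two_le_ncard_of_free M hfree (pair_subset he hf) (by rw [ncard_pair hef])
    have h3 : M.eRk {e, f} ≤ 2 := by
      have := M.eRk_le_encard {e, f}
      rwa [encard_pair hef] at this
    exact le_antisymm h3 h2
  have hcirc : ∀ C, M.IsCircuit C → 3 ≤ C.encard := three_le_encard_of_circuit M hL hs
  have hd : M.E.encard = M.eRank + d := by
    rw [hR, ← M.ground_finite.cast_ncard_eq, hn]
    push_cast
    ring
  -- the nullity cap: every `X ⊆ E` has `|X| ≤ r(X) + d`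
  have hcap : ∀ X ⊆ M.E, ∀ k : ℕ, M.eRk X ≤ k → X.ncard ≤ k + d := by
    intro X hX k hr
    have h1 := Matroid.encard_le_eRk_add_of_encard_eq hX hd
    have h2 : X.encard ≤ (k : ℕ∞) + d := h1.trans (by gcongr)
    have hfin : X.Finite := M.ground_finite.subset hX
    rw [← hfin.cast_ncard_eq] at h2
    exact_mod_cast h2
  have hflat : ∀ X ⊆ M.E, M.eRk X ≤ 6 → X.ncard ≤ min 39 (6 + d) :=
    fun X hX hr => le_min (ncard_le_thirtynine_of_eRk_le_six_of_free M hfree hX hr) (hcap X hX 6 hr)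
  have hflat' : ∀ X ⊆ M.E, M.eRk X ≤ ((6 - 1 : ℕ) : ℕ∞) → X.ncard ≤ min 19 (5 + d) :=
    fun X hX hr => le_min (ncard_le_nineteen_of_eRk_le_five_of_free M hfree hX (by simpa using hr))
      (hcap X hX 5 (by simpa using hr))
  -- the small-rank nullity caps
  have hc : ∀ X ⊆ M.E, M.eRk X ≤ ((6 - 2 : ℕ) : ℕ∞) → (X.ncard : ℕ∞) ≤ M.eRk X + cnull 4 :=
    fun X hX hr => nullity_cap_core M hfree 4 (le_refl 4) X hX (by simpa using hr)
  have hc6 : cnull 4 + 1 ≤ ν₁ := by simp [cnull]; omega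
  have hcj : ∀ X ⊆ M.E, M.eRk X ≤ ((6 - j - 1 : ℕ) : ℕ∞) → (X.ncard : ℕ∞) ≤ M.eRk X + cnull (5 - j) :=
    fun X hX hr => nullity_cap_core M hfree (5 - j) (by omega) X hX
      (by rwa [show (6 - j - 1 : ℕ) = 5 - j by omega] at hr)
  have hcj' : ∀ X ⊆ M.E, M.eRk X ≤ ((6 - 1 - j' - 1 : ℕ) : ℕ∞) → (X.ncard : ℕ∞) ≤ M.eRk X + cnull (4 - j') :=
    fun X hX hr => nullity_cap_core M hfree (4 - j') (by omega) X hX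
      (by rwa [show (6 - 1 - j' - 1 : ℕ) = 4 - j' by omega] at hr)
  -- (U): the heavy / light count
  have hU1 := Matroid.topCount_le_ncard_compl (M := M) hR hd 6
  have hG := Matroid.ncard_eRk_eq_ncard_le_le_heavy_sq M 6 (min 19 (5 + d)) ν₁ (by norm_num) hcirc d
  -- the pair classes
  have hPs : (((Matroid.pairsLight M 6 ν₁).filter (fun p => p ∈ Matroid.pairsSmall M 6 (min 19 (5 + d)))).card : ℚ) ≤
      ∑ k ∈ Finset.Icc 3 (6 + 1), ({C | M.IsCircuit C ∧ C.ncard = k}.ncard : ℚ) * (M.E.ncard.choose (6 + 1 - k) : ℚ) := by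
    have h1 := (Matroid.card_pairsLightSmall_le (M := M) 6 (min 19 (5 + d)) ν₁).trans (Matroid.card_pairsF_le 6)
    have : ((((Matroid.pairsLight M 6 ν₁).filter (fun p => p ∈ Matroid.pairsSmall M 6 (min 19 (5 + d)))).card : ℕ) : ℚ) ≤
        ((∑ k ∈ Finset.Icc 3 (6 + 1), {C | M.IsCircuit C ∧ C.ncard = k}.ncard * M.E.ncard.choose (6 + 1 - k) : ℕ) : ℚ) := by
      exact_mod_cast h1
    push_cast at this
    exact this
  have hPb : (((Matroid.pairsLight M 6 ν₁).filter (fun p => p ∉ Matroid.pairsSmall M 6 (min 19 (5 + d)))).card : ℚ) ≤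
      ((b : ℕ) : ℚ) * ∑ k ∈ Finset.Icc 3 (6 + 1), ({C | M.IsCircuit C ∧ C.ncard = k}.ncard : ℚ) * (M.E.ncard.choose (6 + 1 - k) : ℚ) := by
    rcases hb with hb0 | hb1
    · rw [Matroid.card_pairsBigLight_eq_zero 6 (min 19 (5 + d)) ν₁ hb0]
      have : (0 : ℚ) ≤ ((b : ℕ) : ℚ) * ∑ k ∈ Finset.Icc 3 (6 + 1), ({C | M.IsCircuit C ∧ C.ncard = k}.ncard : ℚ) *
          (M.E.ncard.choose (6 + 1 - k) : ℚ) := by positivity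
      simpa using this
    · rw [hb1]
      push_cast
      rw [one_mul]
      have h1 := (Matroid.card_pairsBigLight_le (M := M) 6 (min 19 (5 + d)) ν₁).trans (Matroid.card_pairsF_le 6)
      have : ((((Matroid.pairsLight M 6 ν₁).filter (fun p => p ∉ Matroid.pairsSmall M 6 (min 19 (5 + d)))).card : ℕ) : ℚ) ≤
          ((∑ k ∈ Finset.Icc 3 (6 + 1), {C | M.IsCircuit C ∧ C.ncard = k}.ncard * M.E.ncard.choose (6 + 1 - k) : ℕ) : ℚ) := by
        exact_mod_cast h1
      push_cast at this
      exact this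
  -- the heavy sets
  have hUG : (Matroid.UG M 6 ν₁).ncard ≤ uG := by
    rcases huG with huG | ⟨hu1, hu2⟩
    · have := Matroid.ncard_UG_le (M := M) (q := 6) (ν₁ := ν₁) (j := j) (by norm_num) hd hc hc6 hcj hνj
      omega
    · exact (Matroid.ncard_UG_le_of_unique (M := M) (q := 6) (ν₁ := ν₁) hd (nullity_cap_core_five M hfree) hu1
        (fun X hX hr => hflat X hX (by simpa using hr))).trans hu2
  have hUH : (Matroid.UH M 6 ν₁).ncard ≤ uH := by
    rcases huH with h | ⟨h1, h2⟩ | h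
    · have := Matroid.ncard_UH_le (M := M) (q := 6) (ν₁ := ν₁) (j' := j') (by norm_num) hd hc hc6 hcj' hνj'
      omega
    · have hνc : d + cnull 4 + 1 ≤ 2 * ν₁ := by simp [cnull]; omega
      exact (Matroid.ncard_UH_le_of_unique (M := M) (q := 6) hd hc hνc hflat').trans h2
    · rw [Matroid.UH_eq_empty (M := M) (q := 6) (ν₁ := ν₁) hflat' (by omega)]
      simp
  have hHv : ({B : Set α | B ⊆ M.E ∧ M.eRk B = (6 : ℕ) ∧ 6 + ν₁ ≤ (M.closure B).ncard}.ncard : ℚ) ≤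
      (2 : ℚ) ^ uG + (((p + d : ℕ) : ℚ) + 1) * (2 : ℚ) ^ uH := by
    have h1 := Matroid.ncard_heavy_le (M := M) 6 ν₁
    have h2 : 2 ^ (Matroid.UG M 6 ν₁).ncard + (M.E.ncard + 1) * 2 ^ (Matroid.UH M 6 ν₁).ncard ≤
        2 ^ uG + (p + d + 1) * 2 ^ uH := by
      rw [hn]
      exact Nat.add_le_add (Nat.pow_le_pow_right (by norm_num) hUG)
        (Nat.mul_le_mul_left _ (Nat.pow_le_pow_right (by norm_num) hUH))
    exact_mod_cast h1.trans h2
  -- the circuit bounds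
  have hC1 : ∀ L ⊆ M.E, M.eRk L = 2 → L.ncard ≤ 3 :=
    fun L hL hr => ncard_le_three_of_eRk_two M hs hfree hL hr
  have hC2 : ∀ P ⊆ M.E, M.eRk P ≤ 3 → P.ncard ≤ 6 :=
    fun P hP hr => ncard_le_six_of_eRk_le_three_of_free M hfree hP hr
  have hs3 : {C | M.IsCircuit C ∧ C.ncard = 3}.ncard ≤ (d * d + 8 - 3 * d) / 2 :=
    S1.ncard_triangles_le_of_nullity_plane M hC1 hC2 hd
  have hs4 : {C | M.IsCircuit C ∧ C.ncard = 4}.ncard ≤ d * (d + 1) * (d + 2) / 4 := by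
    have hT4 : 4 * {C : Set α | M.IsCircuit C ∧ C.ncard = 4}.ncard ≤ d * (d + 1) * (d + 2) :=
      S1.four_mul_ncard_fourCircuits_le M hfree hd
    omega
  have hs5 : {C | M.IsCircuit C ∧ C.ncard = 5}.ncard ≤ (d + 4).choose 5 :=
    Matroid.ncard_circuits_le_choose_of_encard M hd 4
  have hs6 : {C | M.IsCircuit C ∧ C.ncard = 6}.ncard ≤ (d + 5).choose 6 :=
    Matroid.ncard_circuits_le_choose_of_encard M hd 5
  have hs7 : {C | M.IsCircuit C ∧ C.ncard = 7}.ncard ≤ (d + 6).choose 7 :=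
    Matroid.ncard_circuits_le_choose_of_encard M hd 6
  have hs3q : ({C | M.IsCircuit C ∧ C.ncard = 3}.ncard : ℚ) ≤ (((d * d + 8 - 3 * d) / 2 : ℕ) : ℚ) := by exact_mod_cast hs3
  have hs4q : ({C | M.IsCircuit C ∧ C.ncard = 4}.ncard : ℚ) ≤ ((d * (d + 1) * (d + 2) / 4 : ℕ) : ℚ) := by
    exact_mod_cast hs4
  have hs5q : ({C | M.IsCircuit C ∧ C.ncard = 5}.ncard : ℚ) ≤ (((d + 4).choose 5 : ℕ) : ℚ) := by exact_mod_cast hs5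
  have hs6q : ({C | M.IsCircuit C ∧ C.ncard = 6}.ncard : ℚ) ≤ (((d + 5).choose 6 : ℕ) : ℚ) := by exact_mod_cast hs6
  have hs7q : ({C | M.IsCircuit C ∧ C.ncard = 7}.ncard : ℚ) ≤ (((d + 6).choose 7 : ℕ) : ℚ) := by exact_mod_cast hs7
  -- the pair sum in explicit form
  have hPexp : ∑ k ∈ Finset.Icc 3 (6 + 1), ({C | M.IsCircuit C ∧ C.ncard = k}.ncard : ℚ) * (M.E.ncard.choose (6 + 1 - k) : ℚ) ≤
      (((d * d + 8 - 3 * d) / 2 : ℕ) : ℚ) * ((p + d).choose 4 : ℚ) + ((d * (d + 1) * (d + 2) / 4 : ℕ) : ℚ) * ((p + d).choose 3 : ℚ) +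
        (((d + 4).choose 5 : ℕ) : ℚ) * ((p + d).choose 2 : ℚ) + (((d + 5).choose 6 : ℕ) : ℚ) * ((p + d : ℕ) : ℚ) +
        (((d + 6).choose 7 : ℕ) : ℚ) := by
    rw [show (6 : ℕ) + 1 = 7 from rfl, sum_Icc_three_seven_q, hn]
    simp only [show (7 : ℕ) - 3 = 4 from rfl, show (7 : ℕ) - 4 = 3 from rfl, show (7 : ℕ) - 5 = 2 from rfl,
      show (7 : ℕ) - 6 = 1 from rfl, show (7 : ℕ) - 7 = 0 from rfl, Nat.choose_one_right, Nat.choose_zero_right,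
      mul_one, Nat.cast_one]
    gcongr
  set Pq := (((d * d + 8 - 3 * d) / 2 : ℕ) : ℚ) * ((p + d).choose 4 : ℚ) + ((d * (d + 1) * (d + 2) / 4 : ℕ) : ℚ) * ((p + d).choose 3 : ℚ) +
        (((d + 4).choose 5 : ℕ) : ℚ) * ((p + d).choose 2 : ℚ) + (((d + 5).choose 6 : ℕ) : ℚ) * ((p + d : ℕ) : ℚ) +
        (((d + 6).choose 7 : ℕ) : ℚ) with hPq
  have hσ1 : (0 : ℚ) ≤ ∑ i ∈ Finset.range (d - (6 + 1) + 1), ((Nat.choose (min (min 19 (5 + d) - 6) (ν₁ - 2)) i : ℕ) : ℚ) / (((i : ℚ) + 1) ^ 2) :=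
    Finset.sum_nonneg (fun i _ => by positivity)
  have hσ2 : (0 : ℚ) ≤ ∑ i ∈ Finset.range (d - (6 + 1) + 1), ((Nat.choose (ν₁ - 2) i : ℕ) : ℚ) / (((i : ℚ) + 1) ^ 2) :=
    Finset.sum_nonneg (fun i _ => by positivity)
  have hUq : (Matroid.topCount M p 6 : ℚ) ≤ ((p + d).choose 6 : ℚ) +
      ((∑ i ∈ Finset.range (d - 7 + 1), ((Nat.choose (min (min 19 (5 + d) - 6) (ν₁ - 2)) i : ℕ) : ℚ) / (((i : ℚ) + 1) ^ 2)) * Pq +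
        ((b : ℕ) : ℚ) * (∑ i ∈ Finset.range (d - 7 + 1), ((Nat.choose (ν₁ - 2) i : ℕ) : ℚ) / (((i : ℚ) + 1) ^ 2)) * Pq +
        (2 : ℚ) ^ uG + (((p + d : ℕ) : ℚ) + 1) * (2 : ℚ) ^ uH) := by
    have h1 : (Matroid.topCount M p 6 : ℚ) ≤
        ({B : Set α | B ⊆ M.E ∧ M.eRk B = 6 ∧ B.ncard ≤ d}.ncard : ℚ) := by exact_mod_cast hU1
    refine h1.trans (hG.trans ?_)
    have e1 := mul_le_mul_of_nonneg_left (hPs.trans hPexp) hσ1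
    have e2 := mul_le_mul_of_nonneg_left (hPb.trans (mul_le_mul_of_nonneg_left hPexp (by positivity))) hσ2
    simp only [show (6 : ℕ) + 1 = 7 from rfl] at e1 e2 ⊢
    rw [hn]
    have h3 := add_le_add (add_le_add (add_le_add (le_refl (((p + d).choose 6 : ℕ) : ℚ)) e1) e2) hHv
    refine h3.trans (le_of_eq ?_)
    ring
  -- (Y)
  have hY := Matroid.two_pow_le_midCount_add (M := M) p 6 hR
  have hA : {X : Set α | X ⊆ M.E ∧ M.eRk X ≤ 6}.ncard ≤ ∑ j ∈ Finset.range (a + 1), (p + d).choose j := by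
    calc {X : Set α | X ⊆ M.E ∧ M.eRk X ≤ 6}.ncard
        ≤ {X : Set α | X ⊆ (M.ground_finite.toFinset : Set α) ∧ X.ncard ≤ a}.ncard := by
          apply ncard_le_ncard
          · intro X hX
            exact ⟨by rw [Set.Finite.coe_toFinset]; exact hX.1, (hflat X hX.1 hX.2).trans ha⟩
          · exact (Finset.finite_toSet _).finite_subsets.subset (fun X hX => hX.1)
      _ ≤ ∑ j ∈ Finset.range (a + 1), M.ground_finite.toFinset.card.choose j :=
          ncard_subsets_ncard_le _ a
      _ = ∑ j ∈ Finset.range (a + 1), (p + d).choose j := by rw [hEcard]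
  -- the flat-count bound of the rank-`≤ 6` sets: rank `≤ 5` sets have `≤ 19` points, rank-`6` sets are `≤ C(n, 6)·2^{33}`
  have hA' : {X : Set α | X ⊆ M.E ∧ M.eRk X ≤ 6}.ncard ≤
      ∑ j ∈ Finset.range (19 + 1), (p + d).choose j + 2 ^ (39 - 6) * ∑ j ∈ Finset.range (6 + 1), (p + d).choose j := by
    have hsub : {X : Set α | X ⊆ M.E ∧ M.eRk X ≤ 6} ⊆
        {X : Set α | X ⊆ (M.ground_finite.toFinset : Set α) ∧ X.ncard ≤ 19} ∪ {X : Set α | X ⊆ M.E ∧ M.eRk X = 6} := by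
      intro X hX
      rcases eq_or_ne (M.eRk X) 6 with h6 | h6
      · exact Or.inr ⟨hX.1, h6⟩
      · left
        refine ⟨by rw [Set.Finite.coe_toFinset]; exact hX.1, ?_⟩
        have hlt : M.eRk X < 6 := lt_of_le_of_ne hX.2 h6
        have h5 : M.eRk X ≤ ((6 - 1 : ℕ) : ℕ∞) := by
          have h51 : (6 : ℕ∞) = (5 : ℕ∞) + 1 := by norm_num
          rw [h51, ENat.lt_add_one_iff (by simp)] at hlt
          simpa using hlt
        exact (hflat' X hX.1 h5).trans (min_le_left _ _)
    have hfin1 : {X : Set α | X ⊆ (M.ground_finite.toFinset : Set α) ∧ X.ncard ≤ 19}.Finite :=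
      (Finset.finite_toSet _).finite_subsets.subset (fun X hX => hX.1)
    have hfin2 : {X : Set α | X ⊆ M.E ∧ M.eRk X = 6}.Finite :=
      M.ground_finite.finite_subsets.subset (fun X hX => hX.1)
    calc {X : Set α | X ⊆ M.E ∧ M.eRk X ≤ 6}.ncard
        ≤ ({X : Set α | X ⊆ (M.ground_finite.toFinset : Set α) ∧ X.ncard ≤ 19} ∪
            {X : Set α | X ⊆ M.E ∧ M.eRk X = 6}).ncard := ncard_le_ncard hsub (hfin1.union hfin2)
      _ ≤ {X : Set α | X ⊆ (M.ground_finite.toFinset : Set α) ∧ X.ncard ≤ 19}.ncard +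
            {X : Set α | X ⊆ M.E ∧ M.eRk X = 6}.ncard := ncard_union_le _ _
      _ ≤ ∑ j ∈ Finset.range (19 + 1), (p + d).choose j + 2 ^ (39 - 6) * ∑ j ∈ Finset.range (6 + 1), (p + d).choose j := by
          gcongr
          · rw [← hEcard]; exact ncard_subsets_ncard_le _ 19
          · have h39 : ∀ X ⊆ M.E, M.eRk X ≤ 6 → X.ncard ≤ 39 :=
              fun X hX hr => ncard_le_thirtynine_of_eRk_le_six_of_free M hfree hX hr
            have h1 := ncard_eRk_eq_le_choose_mul_of_bound M 6 39 h39
            rw [hEcard] at h1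
            have h2 : (p + d).choose 6 ≤ ∑ j ∈ Finset.range (6 + 1), (p + d).choose j :=
              Finset.single_le_sum (f := fun j => (p + d).choose j) (fun _ _ => Nat.zero_le _) (Finset.self_mem_range_succ 6)
            calc {X : Set α | X ⊆ M.E ∧ M.eRk X = 6}.ncard ≤ (p + d).choose 6 * 2 ^ (39 - 6) := h1
              _ ≤ (∑ j ∈ Finset.range (6 + 1), (p + d).choose j) * 2 ^ (39 - 6) := Nat.mul_le_mul_right _ h2
              _ = 2 ^ (39 - 6) * ∑ j ∈ Finset.range (6 + 1), (p + d).choose j := by ring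
  have hB := Matroid.ncard_spanning_le (M := M) hd
  rw [hEcard] at hY hB
  -- the tails (either form)
  have hAB : Kn * ({X : Set α | X ⊆ M.E ∧ M.eRk X ≤ 6}.ncard +
      {X : Set α | X ⊆ M.E ∧ M.eRk X = M.eRank}.ncard) ≤ Kd * 2 ^ (p + d) := by
    rcases htail with htail | htail
    · have h1 : Kn * ({X : Set α | X ⊆ M.E ∧ M.eRk X ≤ 6}.ncard +
          {X : Set α | X ⊆ M.E ∧ M.eRk X = M.eRank}.ncard) ≤
          Kn * (∑ j ∈ Finset.range (a + 1), (p + d).choose j + ∑ j ∈ Finset.range (d + 1), (p + d).choose j) :=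
        Nat.mul_le_mul_left _ (Nat.add_le_add hA hB)
      exact h1.trans htail
    · have h1 : Kn * ({X : Set α | X ⊆ M.E ∧ M.eRk X ≤ 6}.ncard +
          {X : Set α | X ⊆ M.E ∧ M.eRk X = M.eRank}.ncard) ≤
          Kn * (∑ j ∈ Finset.range (19 + 1), (p + d).choose j + 2 ^ (39 - 6) * ∑ j ∈ Finset.range (6 + 1), (p + d).choose j +
            ∑ j ∈ Finset.range (d + 1), (p + d).choose j) :=
        Nat.mul_le_mul_left _ (Nat.add_le_add hA' hB)
      exact h1.trans htail
  -- (Φ) and the polynomial inequality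
  have hΦ := phiK_le_two_pow_div p 6
  rw [Nat.choose_symm_add] at hΦ
  -- assemble in `ℚ`
  rw [RLS_iff]
  have hYq : (2 : ℚ) ^ (p + d) ≤ (Matroid.midCount M p 6 : ℚ) +
      ({X : Set α | X ⊆ M.E ∧ M.eRk X ≤ 6}.ncard : ℚ) +
      ({X : Set α | X ⊆ M.E ∧ M.eRk X = M.eRank}.ncard : ℚ) := by exact_mod_cast hY
  have hKdq : (0 : ℚ) < (Kd : ℚ) := by exact_mod_cast hKd
  have hABq : ((Kn : ℚ) / (Kd : ℚ)) * (({X : Set α | X ⊆ M.E ∧ M.eRk X ≤ 6}.ncard : ℚ) +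
      ({X : Set α | X ⊆ M.E ∧ M.eRk X = M.eRank}.ncard : ℚ)) ≤ 2 ^ (p + d) := by
    have h : (Kn : ℚ) * (({X : Set α | X ⊆ M.E ∧ M.eRk X ≤ 6}.ncard : ℚ) +
        ({X : Set α | X ⊆ M.E ∧ M.eRk X = M.eRank}.ncard : ℚ)) ≤ (Kd : ℚ) * 2 ^ (p + d) := by exact_mod_cast hAB
    rw [div_mul_eq_mul_div, div_le_iff₀ hKdq]
    linarith
  have hU0 : (0 : ℚ) ≤ (Matroid.topCount M p 6 : ℚ) := Nat.cast_nonneg _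
  have hd6 : 6 ≤ d := by omega
  have hKq : (0 : ℚ) < (Kn : ℚ) / (Kd : ℚ) := by
    apply div_pos _ hKdq
    exact_mod_cast (by omega : 0 < Kn)
  have hLq : ((Kn - Kd : ℕ) : ℚ) / (Kd : ℚ) + 1 = (Kn : ℚ) / (Kd : ℚ) := by
    rw [Nat.cast_sub (by omega : Kd ≤ Kn), div_add_one hKdq.ne']
    ring
  have hpoly' : ((Kn : ℚ) / (Kd : ℚ)) * ((((p + d).choose 6 : ℕ) : ℚ) +
      ((∑ i ∈ Finset.range (d - 7 + 1), ((Nat.choose (min (min 19 (5 + d) - 6) (ν₁ - 2)) i : ℕ) : ℚ) / (((i : ℚ) + 1) ^ 2)) * Pq +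
        ((b : ℕ) : ℚ) * (∑ i ∈ Finset.range (d - 7 + 1), ((Nat.choose (ν₁ - 2) i : ℕ) : ℚ) / (((i : ℚ) + 1) ^ 2)) * Pq +
        (2 : ℚ) ^ uG + (((p + d : ℕ) : ℚ) + 1) * (2 : ℚ) ^ uH)) ≤
      (((Kn - Kd : ℕ) : ℚ) / (Kd : ℚ)) * 2 ^ (d - 6) * (((p + 6).choose 6 : ℕ) : ℚ) := by
    rw [div_mul_eq_mul_div, div_mul_eq_mul_div, div_mul_eq_mul_div]
    exact div_le_div_of_nonneg_right hpoly hKdq.le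
  exact level_arith_K (p := p) (d := d) (n := p + d) (q := 6) rfl hd6 hKq hLq hΦ hU0 hUq hYq hABq hpoly'

end ThmN

end PercRepro
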